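import Literature.MathematicalPhysics.QuantumFieldTheory.Balaban1983to89.B9Letters313AtOneQ
import Literature.MathematicalPhysics.QuantumFieldTheory.Balaban1983to89.B9PinMembersKLevelV1

/-!
# `Balaban1983to89.B9QstarLettersAtPins` — THE KINEMATIC LETTER `Q*(U)` AT THE PINS: node00-def-Y's coordinate model `QscoKH` of the
# adjoint averaging operator is LOCAL (radius `ℓ + 4`) and BOUNDED — by the plateau weight `n_{y′}⁻¹ = L^{−(d+1)j(y′)}` in the sharp-block sup
# classes, by its square root in the block-L² classes — at EVERY gauge-group-valued configuration `U`, uniformly on the k-level census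

T. Bałaban, *Propagators for lattice gauge theories in a background field*, Commun. Math. Phys. **99** (1985) 389–434
[`Balaban1985BackgroundPropagators`, "B9"]; [4] = T. Bałaban, *Propagators and renormalization transformations for lattice gauge
theories. II*, Commun. Math. Phys. **96** (1984) 223–250 [`Balaban1984PropagatorsII`]; [3] = part I, Commun. Math. Phys. **95** (1984) 17–40
[`Balaban1984PropagatorsI`].

statement-level skeleton of published theorems with citation tags; proofs where landed; nothing here is a claim about the Yang–Mills
mass gap

THE PRINTED LOCI (verbatim).  [B9] (3.12)–(3.14) p. 393 (the covariant averaging `Q(U)` of bond functions over the straight contours of a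
block, transported to the initial point of the coarse bond) and *"Q\* the adjoint of Q"* (3.13); (3.110) p. 417 (the normalisation of the
averaging weights); p. 426 (Thm 3.13): *"The formulas (3.147), (3.153) permit us to reduce properties of the operators 𝔓, 𝔊 to the corresponding
properties of the operators G′, (Q′G′²Q′\*)⁻¹, G₁, (QG₁Q\*)⁻¹"* — the composites `∇_UG₀Q*`, `Φ_β∇_UG₀Q*`, `G₀Q*`, … of Theorems 3.12 ∕ 3.13 are
`G₀`-letters composed with the ONE kinematic letter `Q*`; [3] (1.18) p. 20 ∕ [4] (2.18)–(2.20) p. 226 (the weights `q_y(f) ≥ 0`, total mass one,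
`q_y(f) ≤ L^{−j(d+1)}`); [4] (2.51)–(2.52) p. 232 (block majorants).

THE POINT (cell `pub-ymgap`, node N06, width piece W-c face `hLHH`, dag-lead DEDUP-381 ∕ dag-n06-l COORD-1, 2026-08-28).  dag-n06-l's supplier file
`B9Thm313WholeQstarFromG0` proves the eleven displayed `Q*`-composite letter fields of rows 20–21 of dag-n06-d's N06 certificate (`LettersHHZ.pQ`,
`Letters313*.gQs2 ∕ gQs1 ∕ dgQs ∕ dgQsd ∕ pQd ∕ pXQs`, L² `gQs ∕ dGQs ∕ ddGQs ∕ dGQsd`) from rows 19's DERIVED `G₀`-material modulo ONE kinematic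
letter of `Q*` in the sup classes (`hqs : HasMaj (weightNorm (ofBlocks blkZ) n⁻¹ _) (cNorm … blk 0) (𝔬.Qstar U) (B_Q·e^{−δ_Q d})`) and its block-L²
twin.  THIS FILE proves both letters AT THE PINS — for node00-def-Y's model `QscoKH i b B cfg parB U₁ = (cR39 b)⁻¹ • coordOpKH b (Q*(U))`
(`Node00.OpsYSectDCoords`, the certificate's pin `hQsco12`) with dag-n06-d's carriers `XHK` (block map `blkHK`) and `XBK` (block map `blkBK bI`,
`bI` 1-faithful), at EVERY configuration whose contour transporters are norm-contractions (`‖U(Γ)‖ ≤ 1`, `‖U(Γ)⁻¹‖ ≤ 1`: every `G`-valued `U` with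
`G ≤ U1`, in particular the certificate's `SU(N)`-valued regular configurations), with constants INDEPENDENT of the member and of `U`:
* §1 (after a private contraction lemma) the model, unfolded: at an input localised at the coarse bond `y′`, `(Q*μ)(f, ν, c, c′) = (cR39 b)⁻¹·q_{y′}(f)·repr_c(R(U(Γ)⁻¹)v_{ν,c′})`
  (`QscoKH_apply_of_loc`), whence the pointwise bound `|(Q*μ)(f,…)| ≤ q_{y′}(f)·(cR39 b)⁻¹·coordBound·basisBound·Σ_a|μ(y′,ν,a,c′)|`
  (`abs_QscoKH_apply_le`: the transporter is a norm contraction, the coordinates are read by n06-d's `abs_repr_le ∕ norm_sum_smul_basis_le`);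
* §2 ★★ THE SUP LETTER `hasMaj_QscoKH`: `Q*(U₁) : 𝔠_Z^{(0), n⁻¹} → 𝔠⁽⁰⁾` with majorant `e^{δ(ℓ+4)}·e^{−δd(y,y′)}` for EVERY `δ ≥ 0` (the reading constant
  `(cR39 b)⁻¹·coordBound·basisBound·|κ|` collapses to `≤ 1`; `q_{y′} ≤ n_{y′}⁻¹` is r03's `qwt_le`; the support radius `ℓ + 4` is dag-n06-w3's
  `dist_le_of_qwt_ne_zero_bI`), its two-space form `hasMajorantHom_QscoKH`, and the letter-record form `hasMaj_Qstar_of_pins` (any `Ops` record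
  pinned by `hblk ∕ hblkZ ∕ hQs` — the certificate's `hblk12 ∕ hblkZ12 ∕ hQsco12`);
* §3 AT def-Y's MEMBERS: `parBY_norm_le_one_of_reg335` (a (3.35)-regular configuration of `bg9Y … (specialUnitaryUnits (Fin N)) x` has
  contracting taxi transporters `parBY`) and the member-level sup letter `hasMaj_Qstar_pins` at `QscoKH x.toKIdx (trBasis N) (bg9Y …) (fun U => U)
  (parBY x.toKIdx) U`, EVERY member `x`, every regular `U`.  The block-L² twin is the sequel `B9QstarLettersAtPinsL2`.

HONEST SCOPE.  Finite-dimensional lattice bookkeeping for ONE kinematic letter (no propagator, no estimate of [B9] at curved `U` is asserted; the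
inputs are r03's weight facts `qwt_nonneg ∕ qwt_le ∕ sum_qwt_eq_one`, dag-n06-h∕-w3's support radius, n06-d's coordinate dictionary, def-Y's
`parBY_mem`, all cited by name).  A helper for the N06 certificate (the `hqs`-inputs of dag-n06-l's `pQ_of_h43` and siblings become `have`s at the
pins); COUNT-NEUTRAL; N06 is NOT discharged; one finite lattice at a time; nothing continuum, nothing about the mass gap ∕ Clay.  Cell `pub-ymgap`
(HUMAN RULING D-0062 ∕ D-0154), Track A node N06 [B9], width seat `pub-ymgap-dag-n06-w5` (g0), 2026-08-28.
-/

noncomputable section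

namespace Literature.MathematicalPhysics.QuantumFieldTheory.Balaban1983to89.B9QstarLettersAtPins

open B6Geom246MultiLevelTorus (geomT)
open B6GlobalChartV1 (PV blkV1)
open B6KLevelCensusIndexV1 (KIdx)
open B6RandomWalk (BlockSupp)
open B6RandomWalkHom (HasMajorantHom)
open B6Ineq2142KLevelV1 (lvl β qwt qwt_nonneg qwt_le)
open B9Eq3132Ineq2142Covariant (qK_apply sum_qwt_eq_one)
open B9Eq39Adjoint (R R_zero)
open B9GeoNormsKLevelV1 (geo9K)
open B9GeoLemma21KLevelV1 (geo9K_dist_comm geo9K_len_pos)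
open B9GeoNormsKLevelV1 (geo9K_dist_nonneg)
open B9Thm39ReadingCoords (cR39 cR39_nonneg coordBound39 basisBound39 abs_repr_le norm_sum_smul_basis_le)
open B9Thm34Ext (toB6)
open B9SectDSup (weightNorm)
open B11SectG (HasMaj BlockNorm)
open B9Thm312Whole (cNorm GeoOK Ops wt wt_nonneg)
open B9CoReadingCoords (assembleK XBK blkBK)
open B9CoReadingCoordsH (XHK blkHK coordOpKH_apply)
open B9Letters313AtOneQ (dist_le_of_qwt_ne_zero_bI)
open Node00 Node00.OpsYSectDCoords
open scoped Matrix

variable {d ℓ : ℕ} {hd : 1 ≤ d + 1} {hL : Odd (ℓ + 1) ∧ 1 < ℓ + 1} {b₀ b₁ : ℝ}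

/-! ## §1 The model `Q*(U₁)` unfolded at a localised input; the pointwise bound -/

section Model

variable {𝔸 : Type} [NormedRing 𝔸] [NormedAlgebra ℂ 𝔸] [CompleteSpace 𝔸] [FiniteDimensional ℝ 𝔸]
variable {κ : Type} [Fintype κ]
variable (i : KIdx d ℓ hd hL b₀ b₁) (b : Module.Basis κ ℝ 𝔸) (B : B9.Backgrounds) (cfg : B.Cfg → CfgY 𝔸 i) (parB : BondParY 𝔸 i)

omit [NormedAlgebra ℂ 𝔸] [CompleteSpace 𝔸] [FiniteDimensional ℝ 𝔸] in
/-- A unit that is a norm contraction together with its inverse conjugates contractively: `‖g v g⁻¹‖ ≤ ‖v‖`. [folklore] -/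
private theorem norm_R_le_of_contraction {g : 𝔸ˣ} (h1 : ‖(g : 𝔸)‖ ≤ 1) (h2 : ‖((g⁻¹ : 𝔸ˣ) : 𝔸)‖ ≤ 1) (v : 𝔸) :
    ‖R g v‖ ≤ ‖v‖ := by
  unfold R
  calc ‖(g : 𝔸) * v * ((g⁻¹ : 𝔸ˣ) : 𝔸)‖ ≤ ‖(g : 𝔸) * v‖ * ‖((g⁻¹ : 𝔸ˣ) : 𝔸)‖ := norm_mul_le _ _
    _ ≤ (‖(g : 𝔸)‖ * ‖v‖) * ‖((g⁻¹ : 𝔸ˣ) : 𝔸)‖ := mul_le_mul_of_nonneg_right (norm_mul_le _ _) (norm_nonneg _)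
    _ ≤ (1 * ‖v‖) * 1 :=
        mul_le_mul (mul_le_mul_of_nonneg_right h1 (norm_nonneg _)) h2 (norm_nonneg _) (by positivity)
    _ = ‖v‖ := by ring

omit [CompleteSpace 𝔸] [FiniteDimensional ℝ 𝔸] in
/-- The re-assembled `(ν, ·, c′)`-slice of an input localised at the coarse bond `y′` vanishes at every other coarse bond.
[cite: Balaban1985BackgroundPropagators, (3.13) p.393, dictionary] -/
theorem assembleK_eq_zero_of_loc {μ : XHK κ i → ℝ} {y' : IBondY i} (hoff : ∀ q : XHK κ i, q.1 ≠ y' → μ q = 0)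
    (ν : Fin (d + 1)) (c' : κ) {ι : IBondY i} (hι : ι ≠ y') : assembleK b ν c' μ ι = 0 := by
  show (∑ a, μ (ι, ν, a, c') • b a) = 0
  exact Finset.sum_eq_zero fun a _ => by rw [hoff (ι, ν, a, c') hι, zero_smul]

/-- ★ **THE MODEL `Q*(U₁)` AT A LOCALISED INPUT, UNFOLDED**: for `μ` localised at the coarse bond `y′`,
`(Q*μ)(f, ν, c, c′) = (cR39 b)⁻¹ · (q_{y′}(f) · repr_c (R(U(Γ_{y′,f})⁻¹) v_{ν,c′}))` with `v_{ν,c′} = Σ_a μ(y′, ν, a, c′)·b_a` the re-assembled slice —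
the transposed flat kernel `q_{y′}(f)` of (3.13) and ONE transporter. [cite: Balaban1985BackgroundPropagators, (3.12)–(3.14) p.393 + (3.13) («Q* the adjoint of Q»); Balaban1984PropagatorsII, (2.18)–(2.19) p.226] -/
theorem QscoKH_apply_of_loc (U₁ : B.Cfg) {μ : XHK κ i → ℝ} {y' : IBondY i} (hoff : ∀ q : XHK κ i, q.1 ≠ y' → μ q = 0)
    (p : XBK κ i) :
    QscoKH i b B cfg parB U₁ μ p =
      (cR39 b)⁻¹ * (qwt i.hN i.D i.hk y' p.1 *
        b.repr (R ((qT i parB (cfg U₁) y' p.1)⁻¹) (assembleK b p.2.1 p.2.2.2 μ y')) p.2.2.1) := by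
  simp only [QscoKH, LinearMap.smul_apply, Pi.smul_apply, smul_eq_mul, coordOpKH_apply, LinearMap.restrictScalars_apply]
  congr 1
  have hQ : QsY i parB (cfg U₁) (assembleK b p.2.1 p.2.2.2 μ) p.1 =
      ((qwt i.hN i.D i.hk y' p.1 : ℝ) : ℂ) • R ((qT i parB (cfg U₁) y' p.1)⁻¹) (assembleK b p.2.1 p.2.2.2 μ y') := by
    simp only [QsY, trLiftY_apply]
    rw [Finset.sum_eq_single y']
    · rw [qsK_eq_transpose, Matrix.transpose_apply, qK_apply]
    · intro ι _ hι
      rw [assembleK_eq_zero_of_loc i b hoff p.2.1 p.2.2.2 hι, R_zero, smul_zero]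
    · intro h; exact absurd (Finset.mem_univ y') h
  rw [hQ, Complex.coe_smul, LinearEquiv.map_smul, Finsupp.smul_apply, smul_eq_mul]

/-- ★ **THE POINTWISE BOUND**: if the transporter `U(Γ_{y′,f})` and its inverse are norm contractions, then for `μ` localised at `y′`
`|(Q*μ)(f, ν, c, c′)| ≤ q_{y′}(f) · ((cR39 b)⁻¹ · coordBound · basisBound · Σ_a |μ(y′, ν, a, c′)|)` (the coordinate `c` of a vector is `≤ coordBound·‖·‖`,
the conjugation contracts, the re-assembled slice has norm `≤ basisBound·Σ_a|μ_a|`). [cite: Balaban1985BackgroundPropagators, (3.13) p.393 + (3.42) p.397, dictionary; Balaban1984PropagatorsI, (1.18) p.20] -/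
theorem abs_QscoKH_apply_le (U₁ : B.Cfg)
    (hpar : ∀ s s', ‖(parB (cfg U₁) s s' : 𝔸)‖ ≤ 1 ∧ ‖(((parB (cfg U₁) s s')⁻¹ : 𝔸ˣ) : 𝔸)‖ ≤ 1)
    {μ : XHK κ i → ℝ} {y' : IBondY i} (hoff : ∀ q : XHK κ i, q.1 ≠ y' → μ q = 0) (p : XBK κ i) :
    |QscoKH i b B cfg parB U₁ μ p| ≤
      qwt i.hN i.D i.hk y' p.1 *
        ((cR39 b)⁻¹ * (coordBound39 b * (basisBound39 b * ∑ a, |μ (y', p.2.1, a, p.2.2.2)|))) := by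
  rw [QscoKH_apply_of_loc i b B cfg parB U₁ hoff p]
  have hq0 : 0 ≤ qwt i.hN i.D i.hk y' p.1 := qwt_nonneg _ _ _ _ _
  have hc0 : 0 ≤ (cR39 b)⁻¹ := inv_nonneg.mpr (cR39_nonneg b)
  have hcb : 0 ≤ coordBound39 b := norm_nonneg _
  set g : 𝔸ˣ := (qT i parB (cfg U₁) y' p.1)⁻¹ with hg
  set v : 𝔸 := assembleK b p.2.1 p.2.2.2 μ y' with hv
  -- the transporter `qT … y′ f = parB U (·) f.src` and its inverse are contractions
  have hg1 : ‖(g : 𝔸)‖ ≤ 1 := (hpar _ _).2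
  have hg2 : ‖((g⁻¹ : 𝔸ˣ) : 𝔸)‖ ≤ 1 := by rw [hg, inv_inv]; exact (hpar _ _).1
  have hR : ‖R g v‖ ≤ ‖v‖ := norm_R_le_of_contraction hg1 hg2 v
  have hvn : ‖v‖ ≤ basisBound39 b * ∑ a, |μ (y', p.2.1, a, p.2.2.2)| := norm_sum_smul_basis_le b _
  have hrepr : |b.repr (R g v) p.2.2.1| ≤ coordBound39 b * (basisBound39 b * ∑ a, |μ (y', p.2.1, a, p.2.2.2)|) :=
    (abs_repr_le b (R g v) p.2.2.1).trans (mul_le_mul_of_nonneg_left (hR.trans hvn) hcb)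
  rw [abs_mul, abs_of_nonneg hc0, abs_mul, abs_of_nonneg hq0]
  calc (cR39 b)⁻¹ * (qwt i.hN i.D i.hk y' p.1 * |b.repr (R g v) p.2.2.1|)
      ≤ (cR39 b)⁻¹ * (qwt i.hN i.D i.hk y' p.1 * (coordBound39 b * (basisBound39 b * ∑ a, |μ (y', p.2.1, a, p.2.2.2)|))) :=
        mul_le_mul_of_nonneg_left (mul_le_mul_of_nonneg_left hrepr hq0) hc0
    _ = _ := by ring

omit [CompleteSpace 𝔸] in
/-- The reading constant collapses: `(cR39 b)⁻¹ · coordBound · basisBound · (|κ| · B) ≤ B` for `B ≥ 0` (`cR39 b = coordBound·basisBound·|κ|`).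
[cite: Balaban1985BackgroundPropagators, (3.48) p.398, dictionary] -/
theorem reading_const_collapse {Bμ : ℝ} (hB : 0 ≤ Bμ) :
    (cR39 b)⁻¹ * (coordBound39 b * (basisBound39 b * ((Fintype.card κ : ℝ) * Bμ))) ≤ Bμ := by
  have h : (cR39 b)⁻¹ * (coordBound39 b * (basisBound39 b * ((Fintype.card κ : ℝ) * Bμ))) = ((cR39 b)⁻¹ * cR39 b) * Bμ := by
    simp only [cR39]; ring
  rw [h]
  by_cases hc : cR39 b = 0
  · rw [hc, mul_zero, zero_mul]; exact hB
  · rw [inv_mul_cancel₀ hc, one_mul]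

end Model

/-! ## §2 The sup letter: `Q*(U₁) : 𝔠_Z^{(0), n⁻¹} → 𝔠⁽⁰⁾`, local of radius `ℓ + 4`, majorant `e^{δ(ℓ+4)}·e^{−δd}` -/

section Sup

variable {𝔸 : Type} [NormedRing 𝔸] [NormedAlgebra ℂ 𝔸] [CompleteSpace 𝔸] [FiniteDimensional ℝ 𝔸]
variable {κ : Type} [Fintype κ]
variable (i : KIdx d ℓ hd hL b₀ b₁) (b : Module.Basis κ ℝ 𝔸) (B : B9.Backgrounds) (cfg : B.Cfg → CfgY 𝔸 i) (parB : BondParY 𝔸 i)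
variable {bI : FBondY i → IBondY i}

/-- ★★ **THE SUP LETTER OF `Q*(U₁)` AT THE PINS, TWO-SPACE FORM**: for `bI` 1-faithful and contracting transporters, `Q*(U₁)` (def-Y's `QscoKH`)
from `XHK` (block map `blkHK`) to `XBK` (block map `blkBK bI`) has the [4]-(2.51) majorant `n_{y′}⁻¹·e^{δ(ℓ+4)}·e^{−δd(y,y′)}`, `n_{y′} = L^{(d+1)j(y′)}`,
for every `δ ≥ 0`: `|(Q*μ)(f,…)| ≤ q_{y′}(f)·|μ| ≤ n_{y′}⁻¹·|μ|` and `q_{y′}(f) ≠ 0 ⇒ d(bI f, y′) ≤ ℓ + 4`.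
[cite: Balaban1985BackgroundPropagators, (3.12)–(3.14) p.393, (3.110) p.417, Thm 3.13 p.426 (the letter Q*); Balaban1984PropagatorsI, (1.18) p.20; Balaban1984PropagatorsII, (2.51) p.232] -/
theorem hasMajorantHom_QscoKH
    (hβ1 : ∀ f : FBondY i, (geomT i.D).dist (β i.hN i.D i.hk (bI f)) (blkV1 i.hN i.D f) ≤ 1) {U₁ : B.Cfg}
    (hpar : ∀ s s', ‖(parB (cfg U₁) s s' : 𝔸)‖ ≤ 1 ∧ ‖(((parB (cfg U₁) s s')⁻¹ : 𝔸ˣ) : 𝔸)‖ ≤ 1)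
    {δ : ℝ} (hδ : 0 ≤ δ) (R₀ : ℝ) (H₀ : Prop) [Fintype (geo9K i).Site] :
    HasMajorantHom (g := toB6 (geo9K i) R₀ H₀) (blkHK i) (blkBK i bI) (QscoKH i b B cfg parB U₁)
      (fun a a' => ((((ℓ + 1 : ℕ) : ℝ) ^ (d + 1)) ^ lvl i.hN i.D i.hk a')⁻¹ *
        (Real.exp (δ * ((ℓ : ℝ) + 4)) * Real.exp (-(δ * (geo9K i).dist a a')))) := by
  intro y' μ Bμ hμ p
  change IBondY i at y'
  have hoff : ∀ q : XHK κ i, q.1 ≠ y' → μ q = 0 := fun q hq => hμ.off q hq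
  have hsum : ∑ a, |μ (y', p.2.1, a, p.2.2.2)| ≤ (Fintype.card κ : ℝ) * Bμ := by
    calc ∑ a, |μ (y', p.2.1, a, p.2.2.2)| ≤ ∑ _a : κ, Bμ := Finset.sum_le_sum fun a _ => hμ.bound _ rfl
      _ = (Fintype.card κ : ℝ) * Bμ := by rw [Finset.sum_const, nsmul_eq_mul, Finset.card_univ]
  have hq0 : 0 ≤ qwt i.hN i.D i.hk y' p.1 := qwt_nonneg _ _ _ _ _
  have hpt : |QscoKH i b B cfg parB U₁ μ p| ≤ qwt i.hN i.D i.hk y' p.1 * Bμ := by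
    refine (abs_QscoKH_apply_le i b B cfg parB U₁ hpar hoff p).trans (mul_le_mul_of_nonneg_left ?_ hq0)
    refine le_trans ?_ (reading_const_collapse b hμ.nonneg)
    exact mul_le_mul_of_nonneg_left (mul_le_mul_of_nonneg_left (mul_le_mul_of_nonneg_left hsum
      (Finset.sum_nonneg fun _ _ => norm_nonneg _)) (norm_nonneg _)) (inv_nonneg.mpr (cR39_nonneg b))
  have hpl0 : 0 ≤ ((((ℓ + 1 : ℕ) : ℝ) ^ (d + 1)) ^ lvl i.hN i.D i.hk y')⁻¹ := by positivity
  have hK0 : 0 ≤ ((((ℓ + 1 : ℕ) : ℝ) ^ (d + 1)) ^ lvl i.hN i.D i.hk y')⁻¹ *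
      (Real.exp (δ * ((ℓ : ℝ) + 4)) * Real.exp (-(δ * (geo9K i).dist (blkBK i bI p) y'))) := by positivity
  by_cases hq : qwt i.hN i.D i.hk y' p.1 = 0
  · rw [hq, zero_mul] at hpt
    exact hpt.trans (mul_nonneg hK0 hμ.nonneg)
  · have hnear : (geo9K i).dist (bI p.1) y' ≤ (ℓ : ℝ) + 4 := by
      rw [geo9K_dist_comm]; exact dist_le_of_qwt_ne_zero_bI i hβ1 hq
    have hK1 : 1 ≤ Real.exp (δ * ((ℓ : ℝ) + 4)) * Real.exp (-(δ * (geo9K i).dist (blkBK i bI p) y')) := by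
      rw [← Real.exp_add]
      refine Real.one_le_exp ?_
      change 0 ≤ δ * ((ℓ : ℝ) + 4) + -(δ * (geo9K i).dist (bI p.1) y')
      nlinarith [mul_le_mul_of_nonneg_left hnear hδ]
    calc |QscoKH i b B cfg parB U₁ μ p| ≤ qwt i.hN i.D i.hk y' p.1 * Bμ := hpt
      _ ≤ ((((ℓ + 1 : ℕ) : ℝ) ^ (d + 1)) ^ lvl i.hN i.D i.hk y')⁻¹ * 1 * Bμ := by
          rw [mul_one]; exact mul_le_mul_of_nonneg_right (qwt_le _ _ _ _ _) hμ.nonneg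
      _ ≤ _ := mul_le_mul_of_nonneg_right (mul_le_mul_of_nonneg_left hK1 hpl0) hμ.nonneg

/-- ★★ **THE SUP LETTER OF `Q*(U₁)` AT THE PINS, CLASS FORM** (the `hqs`-input of dag-n06-l's `pQ_of_h43` and of its ten sibling `Q*`-fields):
`Q*(U₁)` from the `n⁻¹`-weighted sharp-block sup class of `XHK` (`weightNorm (ofBlocks blkHK) n⁻¹`) into `𝔠⁽⁰⁾` of `XBK` (`cNorm … (blkBK bI) _ 0`) has the
majorant `e^{δ(ℓ+4)}·e^{−δd(y,y′)}` — every `δ ≥ 0`, every member, every contracting `U₁`.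
[cite: Balaban1985BackgroundPropagators, (3.12)–(3.14) p.393, (3.110) p.417, (3.42) p.397, Thm 3.13 p.426; Balaban1984PropagatorsI, (1.18) p.20; Balaban1984PropagatorsII, (2.51) p.232] -/
theorem hasMaj_QscoKH
    (hβ1 : ∀ f : FBondY i, (geomT i.D).dist (β i.hN i.D i.hk (bI f)) (blkV1 i.hN i.D f) ≤ 1) {U₁ : B.Cfg}
    (hpar : ∀ s s', ‖(parB (cfg U₁) s s' : 𝔸)‖ ≤ 1 ∧ ‖(((parB (cfg U₁) s s')⁻¹ : 𝔸ˣ) : 𝔸)‖ ≤ 1)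
    {δ : ℝ} (hδ : 0 ≤ δ) {R₀ : ℝ} {H₀ : Prop} [Fintype (geo9K i).Site] (hlen : ∀ y : (geo9K i).Site, 0 ≤ (geo9K i).len y)
    (hpl : ∀ y : (geo9K i).Site, 0 ≤ ((((ℓ + 1 : ℕ) : ℝ) ^ (d + 1)) ^ lvl i.hN i.D i.hk y)⁻¹) :
    HasMaj (weightNorm (BlockNorm.ofBlocks (toB6 (geo9K i) R₀ H₀) (blkHK i))
        (fun y => ((((ℓ + 1 : ℕ) : ℝ) ^ (d + 1)) ^ lvl i.hN i.D i.hk y)⁻¹) hpl)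
      (cNorm R₀ H₀ (blkBK i bI) hlen 0) (QscoKH i b B cfg parB U₁)
      (fun a a' => Real.exp (δ * ((ℓ : ℝ) + 4)) * Real.exp (-(δ * (geo9K i).dist a a'))) := by
  have hK0 : ∀ a a' : (geo9K i).Site, 0 ≤ ((((ℓ + 1 : ℕ) : ℝ) ^ (d + 1)) ^ lvl i.hN i.D i.hk a')⁻¹ *
      (Real.exp (δ * ((ℓ : ℝ) + 4)) * Real.exp (-(δ * (geo9K i).dist a a'))) := fun a a' => by positivity
  have h0 := B9Thm37AllNorms.hasMaj_of_hasMajorantHom (G := toB6 (geo9K i) R₀ H₀) (blkHK i) (blkBK i bI) hK0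
    (hasMajorantHom_QscoKH i b B cfg parB hβ1 hpar hδ R₀ H₀)
  show HasMaj _ (weightNorm (BlockNorm.ofBlocks (toB6 (geo9K i) R₀ H₀) (blkBK i bI)) (wt (geo9K i) 0) (wt_nonneg hlen 0)) _ _
  refine B9SectDSup.HasMaj.weight hpl (wt_nonneg hlen 0) h0 fun y y' => le_of_eq ?_
  simp only [wt, pow_zero, inv_one, one_mul, mul_comm]

/-- ★ **LETTER-RECORD FORM**: at any `B9Thm312Whole.Ops` record over `geo9K i` with carriers `XBK ∕ · ∕ XHK ∕ ·` whose block maps and `Q*` at `U₁` are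
pinned to n06-d's carriers and def-Y's model (the certificate's `hblk12 ∕ hblkZ12 ∕ hQsco12`), the displayed kinematic letter
`HasMaj (weightNorm (ofBlocks 𝔬.blkZ) n⁻¹ _) (cNorm … 𝔬.blk _ 0) (𝔬.Qstar U₁) (e^{δ(ℓ+4)}·e^{−δd})` HOLDS.
[cite: Balaban1985BackgroundPropagators, Thm 3.13 p.426 (the letter Q*), (3.13) p.393, (3.110) p.417; Balaban1984PropagatorsII, (2.51) p.232] -/
theorem hasMaj_Qstar_of_pins {Y W : Type} [Fintype Y] [Fintype W] [Fintype (geo9K i).Site]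
    (𝔬 : Ops (geo9K i) B (XBK κ i) Y (XHK κ i) W) (hblk : 𝔬.blk = blkBK i bI) (hblkZ : 𝔬.blkZ = blkHK i)
    {U₁ : B.Cfg} (hQs : 𝔬.Qstar U₁ = QscoKH i b B cfg parB U₁)
    (hβ1 : ∀ f : FBondY i, (geomT i.D).dist (β i.hN i.D i.hk (bI f)) (blkV1 i.hN i.D f) ≤ 1)
    (hpar : ∀ s s', ‖(parB (cfg U₁) s s' : 𝔸)‖ ≤ 1 ∧ ‖(((parB (cfg U₁) s s')⁻¹ : 𝔸ˣ) : 𝔸)‖ ≤ 1)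
    {δ : ℝ} (hδ : 0 ≤ δ) {R₀ : ℝ} {H₀ : Prop} (hlen : ∀ y : (geo9K i).Site, 0 ≤ (geo9K i).len y)
    (hpl : ∀ y : (geo9K i).Site, 0 ≤ ((((ℓ + 1 : ℕ) : ℝ) ^ (d + 1)) ^ lvl i.hN i.D i.hk y)⁻¹) :
    HasMaj (weightNorm (BlockNorm.ofBlocks (toB6 (geo9K i) R₀ H₀) 𝔬.blkZ)
        (fun y => ((((ℓ + 1 : ℕ) : ℝ) ^ (d + 1)) ^ lvl i.hN i.D i.hk y)⁻¹) hpl)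
      (cNorm R₀ H₀ 𝔬.blk hlen 0) (𝔬.Qstar U₁)
      (fun a a' => Real.exp (δ * ((ℓ : ℝ) + 4)) * Real.exp (-(δ * (geo9K i).dist a a'))) := by
  rw [hblk, hblkZ, hQs]
  exact hasMaj_QscoKH i b B cfg parB hβ1 hpar hδ hlen hpl

end Sup

/-! ## §3 At node00-def-Y's members: regular configurations have contracting taxi transporters; the sup letter at the certificate's pins -/

section Members

open scoped Matrix.Norms.L2Operator
open B7Prop2SpecialUnitary (specialUnitaryUnits specialUnitaryUnits_le_U1)
open B9PinMembersKLevelV1 (MemberY geo9Y bg9Y reg335Y_iff)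
open B9BackgroundsKLevelV1 (mem_of_reg335)
open B9CoReadingCoordsTranspose (TrIdx trBasis)

variable {Mstar : ℕ} {N : ℕ} [NeZero N]

/-- **A (3.35)-REGULAR CONFIGURATION OF A MEMBER HAS CONTRACTING TAXI TRANSPORTERS**: `Reg335` carries «`U` is `SU(N)`-valued» (def-Y's typing of
p. 396 «U has values in G»), the taxi transporters `parBY` of an `SU(N)`-valued configuration are `SU(N)`-valued (`Node00.parBY_mem`), and
`SU(N) ≤ U1` (operator-norm contractions with contracting inverses, `B7Prop2SpecialUnitary.specialUnitaryUnits_le_U1`).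
[cite: Balaban1985BackgroundPropagators, (3.35) p.396 («U has values in G»), (3.40) p.397 (U(Γ))] -/
theorem parBY_norm_le_one_of_reg335 (x : MemberY d ℓ hd hL b₀ b₁ Mstar) {c α₀ : ℝ}
    {U : (bg9Y (Matrix (Fin N) (Fin N) ℂ) (specialUnitaryUnits (Fin N)) x).Cfg}
    (hU : (bg9Y (Matrix (Fin N) (Fin N) ℂ) (specialUnitaryUnits (Fin N)) x).Reg335 c α₀ U)
    (s s' : Site (PV d ℓ x.toKIdx.m x.toKIdx.K hd hL) 0) :
    ‖(parBY x.toKIdx U s s' : Matrix (Fin N) (Fin N) ℂ)‖ ≤ 1 ∧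
      ‖(((parBY x.toKIdx U s s')⁻¹ : (Matrix (Fin N) (Fin N) ℂ)ˣ) : Matrix (Fin N) (Fin N) ℂ)‖ ≤ 1 := by
  have hG : ∀ μ z, U μ z ∈ specialUnitaryUnits (Fin N) := mem_of_reg335 x.toKIdx ((reg335Y_iff x c α₀ U).1 hU).1
  have hmem := specialUnitaryUnits_le_U1 (parBY_mem x.toKIdx (G := specialUnitaryUnits (Fin N)) hG s s')
  exact hmem

variable [∀ x : MemberY d ℓ hd hL b₀ b₁ Mstar, Fintype (geo9Y x).Site]

/-- ★★ **THE SUP LETTER `Q*(U)` AT THE CERTIFICATE'S PINS, EVERY MEMBER, EVERY REGULAR `U`**: at `QscoKH x.toKIdx (trBasis N) (bg9Y …) (fun U => U)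
(parBY x.toKIdx) U` (the certificate's `hQsco12`), block maps `blkHK x.toKIdx` ∕ `blkBK x.toKIdx (bI x)` (`hblkZ12 ∕ hblk12`, `bI` 1-faithful = `hβ1`):
`HasMaj (weightNorm (ofBlocks blkHK) n⁻¹ _) (cNorm R₀ H₀ (blkBK bI) _ 0) (Q*(U)) (e^{δ(ℓ+4)}·e^{−δd})`, every `δ ≥ 0`.
[cite: Balaban1985BackgroundPropagators, (3.12)–(3.14) p.393, (3.110) p.417, (3.35) p.396, Thm 3.13 p.426; Balaban1984PropagatorsI, (1.18) p.20; Balaban1984PropagatorsII, (2.51) p.232] -/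
theorem hasMaj_Qstar_pins (x : MemberY d ℓ hd hL b₀ b₁ Mstar) {bI : FBondY x.toKIdx → IBondY x.toKIdx}
    (hβ1 : ∀ f : FBondY x.toKIdx, (geomT x.D).dist (β x.hN x.D x.hk (bI f)) (blkV1 x.hN x.D f) ≤ 1) {c α₀ : ℝ}
    {U : (bg9Y (Matrix (Fin N) (Fin N) ℂ) (specialUnitaryUnits (Fin N)) x).Cfg}
    (hU : (bg9Y (Matrix (Fin N) (Fin N) ℂ) (specialUnitaryUnits (Fin N)) x).Reg335 c α₀ U)
    {δ : ℝ} (hδ : 0 ≤ δ) {R₀ : ℝ} {H₀ : Prop} (hlen : ∀ y : (geo9Y x).Site, 0 ≤ (geo9Y x).len y)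
    (hpl : ∀ y : (geo9Y x).Site, 0 ≤ ((((ℓ + 1 : ℕ) : ℝ) ^ (d + 1)) ^ lvl x.hN x.D x.hk y)⁻¹) :
    HasMaj (weightNorm (BlockNorm.ofBlocks (toB6 (geo9Y x) R₀ H₀) (blkHK x.toKIdx))
        (fun y => ((((ℓ + 1 : ℕ) : ℝ) ^ (d + 1)) ^ lvl x.hN x.D x.hk y)⁻¹) hpl)
      (cNorm R₀ H₀ (blkBK x.toKIdx bI) hlen 0)
      (QscoKH x.toKIdx (trBasis N) (bg9Y (Matrix (Fin N) (Fin N) ℂ) (specialUnitaryUnits (Fin N)) x) (fun U => U) (parBY x.toKIdx) U)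
      (fun a a' => Real.exp (δ * ((ℓ : ℝ) + 4)) * Real.exp (-(δ * (geo9Y x).dist a a'))) := by
  letI : Fintype (geo9K x.toKIdx).Site := (inferInstance : Fintype (geo9Y x).Site)
  exact hasMaj_QscoKH x.toKIdx (trBasis N) (bg9Y (Matrix (Fin N) (Fin N) ℂ) (specialUnitaryUnits (Fin N)) x) (fun U => U)
    (parBY x.toKIdx) hβ1 (parBY_norm_le_one_of_reg335 x hU) hδ hlen hpl

end Members

end Literature.MathematicalPhysics.QuantumFieldTheory.Balaban1983to89.B9QstarLettersAtPins

end
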